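import Literature.Probability.RandomPlanarGeometry.HexSAWBrickWallBridgeEnvelope
import Literature.Probability.RandomPlanarGeometry.HexSAWBrickWallBridges
import Literature.Probability.RandomPlanarGeometry.HexSAWHammersleyWelshExplicit
import HarnessLib

/-!
# Hammersley–Welsh on the hexagonal lattice with both constants explicit:
# `c_n(ℍ) ≤ μ_ℍ · e^{6√n} · μ_ℍ^n` for every `n`

Topic `Literature/Probability/RandomPlanarGeometry` (continues `HexSAWBrickWallBridgeEnvelope.lean`:
`c_n(ℍ) ≤ e^{6√n} b_{n+1}(ℍ)` by double unfolding in the brick-wall frame, and `HexSAWBrickWallBridges.lean`: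
`b_n(ℍ) ≤ μ_ℍ^n` by supermultiplicativity of the brick-wall bridges; `HexSAWHammersleyWelshExplicit.lean`: the
shape `HexHWExplicit A κ := ∀ n ≥ 1, c_n(ℍ) ≤ A e^{κ√n} μ_ℍ^n`).

Sources: J. M. Hammersley, D. J. A. Welsh, *Further results on the rate of convergence to the connective
constant of the hypercubical lattice*, Quart. J. Math. Oxford 13 (1962) 108–110 (`c_n ≤ μ^n e^{κ√n}` on `ℤ^d`);
N. Madras, G. Slade, *The Self-Avoiding Walk* (1993), Theorem 3.1.1 with (3.1.7)–(3.1.9), pp. 60–61 (the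
unfolding proof and `b_N ≤ μ^N`); H. Duminil-Copin, S. Smirnov, Ann. of Math. 175 (2012), Theorem 1
(`μ_ℍ = √(2+√2)`).  Status in print: the Hammersley–Welsh bound is printed for `ℤ^d`; for `ℍ` the tree has
`hexHWExplicit_of_pos` (every `κ > 0`, some uncomputed `A`, via Glazman–Manolescu) and the log-stretched numeral
form `hexHWLogStretched_numeral` (`A = 24`, `K = 17800`, `n ≥ 2`); this file records the elementary companion with
BOTH constants small and explicit, `A = μ_ℍ ≤ 1.85`, `κ = 6`, valid for every `n ≥ 0`, read off the brick-wall
bridge machinery of the lane's route R72.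

## Contents (namespace `Literature.Probability.RandomPlanarGeometry.SAW`)

* `HexBW.hexSawCount_le_mu_mul_exp_mul_pow : c_n(ℍ) ≤ μ_ℍ · e^{6√n} · μ_ℍ^n` (all `n`);
* `hexHWExplicit_mu_six : HexHWExplicit hexConnectiveConstant 6`.
-/

noncomputable section

open Finset

namespace Literature.Probability.RandomPlanarGeometry.SAW

namespace HexBW

/-- **`c_n(ℍ) ≤ μ_ℍ · e^{6√n} · μ_ℍ^n` for every `n`**: `c_n(ℍ) ≤ e^{6√n} b_{n+1}(ℍ)` (double unfolding) and
`b_{n+1}(ℍ) ≤ μ_ℍ^{n+1}` (bridge supermultiplicativity). [cite: MadrasSlade1993, Theorem 3.1.1 with (3.1.7)–(3.1.9), pp. 60–61; HammersleyWelsh1962, Theorem] -/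
theorem hexSawCount_le_mu_mul_exp_mul_pow (n : ℕ) :
    (hexSawCount n : ℝ) ≤ hexConnectiveConstant * Real.exp (6 * Real.sqrt n) * hexConnectiveConstant ^ n := by
  have h1 := hexSawCount_le_exp_mul_bridgeCount n
  have h2 := bridgeCount_le_pow (n + 1)
  calc (hexSawCount n : ℝ) ≤ Real.exp (6 * Real.sqrt n) * bridgeCount (n + 1) := h1
    _ ≤ Real.exp (6 * Real.sqrt n) * hexConnectiveConstant ^ (n + 1) :=
        mul_le_mul_of_nonneg_left h2 (Real.exp_nonneg _)
    _ = hexConnectiveConstant * Real.exp (6 * Real.sqrt n) * hexConnectiveConstant ^ n := by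
        rw [pow_succ]
        ring

end HexBW

/-- **Hammersley–Welsh on `ℍ` with explicit constants `A = μ_ℍ`, `κ = 6`**: `c_n(ℍ) ≤ μ_ℍ e^{6√n} μ_ℍ^n` for all
`n ≥ 1` (in fact all `n`). [cite: HammersleyWelsh1962, Theorem; MadrasSlade1993, Theorem 3.1.1] -/
theorem hexHWExplicit_mu_six : HexHWExplicit hexConnectiveConstant 6 := fun n _ =>
  HexBW.hexSawCount_le_mu_mul_exp_mul_pow n

end Literature.Probability.RandomPlanarGeometry.SAW
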